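import Summits.QuantumFields.YangMills.Theorems.BalabanUVNodesK0RecordFormatNamesFluctG
import Summits.QuantumFields.YangMills.Theorems.BalabanUVNodesK0RecordFormatNamesFluctEk
import Summits.QuantumFields.YangMills.Theorems.BalabanUVNodesK0RecordFormatNamesFluctHopC
import Summits.QuantumFields.YangMills.Theorems.BalabanUVNodesPortS1ChartJacobianRecord

/-!
# K0⁷ — THE RECORD-SIDE FORMAT NAMES, EDITION 31 = FLUCTUATION CARRIERS, STAGE 2 OVER A `D̃`-SOCKET: print's (2.12)∕(2.13) exponent `𝐏^{(k)} + {…}` BY SUBTRACTION and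
# `recordFluctIntDtOf` (the CLOSED `recordFluctInt` is its ONE-LINE instance at ▶ PT-A-1's `recordDt`, next leaf)

Cell `ym-nodeO-ideate` ∕ `ym-balaban-port`, DEFINER seat `ym-nodeO-def-1` (gen 39); `--kind definition --supports stmt-QuantumFields-20541 --as helper`; count-neutral.
[I] = [Balaban1987RG1].  Inputs OF RECORD: ▶ PT-A-1's `FE-SPLIT-PROPOSAL-v2.md` §1 (the consumer's signature `recordFluctInt F Mc a₀ ε₂₉ k v n`), `FIBRE-CHART-LAW-v1.md` ((L1)–(L4)),
`EK-CHART-BRICKS-v1.md` ((o4-a)–(o4-e)); ★★★ director-ym №593∕№594 (5) (module + signature pre-worded); ◆ CRIT-1 g38 (D1)–(D4) rulings, nodeO STATUS 2026-08-31 l.5536.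

WHY THIS SHAPE («by subtraction», print's own definition).  [I] p.268: «The expression under the exponential is clearly a sum of two terms, one is connected with the expansion of the
action −(1∕g_k²)A(U_k(V)) and the measure in (2.1), and we denote it by 𝐏^{(k)}(g_k, U_{k+1}, B), another is the expression in the curly bracket {…}» — i.e. 𝐏^{(k)} IS «everything under
the exponential of (2.10) after the change of variables `B′ = B − hD̃(B)`, the scaling `B = g_kB′` and the elimination `B′ = CB`, MINUS the constant `−(1∕g_k²)A(U_{k+1})`, MINUS the Gaussian
quadratic form `−½⟨B′, Δ^{(k)}B′⟩`, MINUS the curly bracket, PLUS the Jacobians of the two changes of variables».  So this file DEFINES the total exponent from the TREE's OWN (0.19)∕(2.1)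
integrand exponent `U ↦ −(1∕g²)·GF(U) + A_k(U)` (✓`B12Eq019ActionBody.integrand` = `χ·exp[−(1∕g_k²)GF + A_k]`; `A_k = effActionHT`, `GF = gfOfRecord`) READ AT THE RE-PARAMETRISED CHART POINT,
subtracts its value at `B′ = 0` (the `B`-dependent «constants» print displays in front of the integral) and the Gaussian part `−½ B_remᵀ·recordPreckLoc·B_rem` that the socket's MEASURE
carries (✓`recordFluctMeasure`), adds the Haar exp-chart Jacobian `log σ` ((o2), ▶ PT-A-1's ✓`fluctSigma`) and the `D̃`-Jacobian `log|det(1 − D(h∘D̃))|` ((o3), a FORMULA), and splits off the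
curly bracket ✓`recordEkBracket` ((o4-a)).  Nothing is expanded term by term (no `V`, `G₃`, `D₃` bookkeeping — that is FE-2's Taylor work); exactness of the split is the content of FE-1's
`FESplitGermBox` ((T1) chart law + (T2) algebra), not asserted here.  THE ONE SOCKET LEFT: `Dt : GaugeField (F.P K) k (SU 2) → (FluctIdx F k K → ℂ) → (PBond (F.P K) (k+1) → MatA 2)` —
print's `D̃` at the background; ▶ PT-A-1's ✓`exists_recordDt` (p827748) inhabits its spec, the NAME `recordDt` (a def) is being landed by ▶ PT-A-1 (★★★ №594 (5)); the closed
`recordFluctInt := recordFluctIntDtOf (recordDt … ρ) …` is the next one-line leaf.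

CONVENTIONS (displayed, for ◆'s cut and FE-1's (T2)): (c1) the variable handed to the exponents by the socket is the all-bonds chart field `B′ : VecField (F.P K) k fluctG3` on the LINEAR
surface (push-forward `recordCopκ` of the remaining variables), read in coordinates by ▶ PT-A-1's ✓`fluctVec` (`(fluctVec x) b a = x (b,a)`); (c2) SCALING: the exponents are evaluated at
`Y_g(x) := g•x − Re(h_ℂ D̃(g•x))` («B = g_kB′», «B′ = B − hD̃(B)»; real part = exact where `D̃` maps real points to `𝔰𝔲(2)` — a bridge theorem of the consumer, junk-free here); (c3) the
cut-off radius `ε₁` of the socket is in the SCALED variable (print's (2.9) radius is `g_k·ε₁` here; its alternative «(g_k∕γ_k)ε₁» p.266 is this convention) and stays `D̃`-FREE because `h` is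
supported on the `b₀`-rows ((D1)); (c4) the Gaussian part subtracted is `½·B_remᵀ (recordPreckLoc … a₀ (portVkAx … B) (hopLinGraph …)) B_rem` — EXACTLY the precision of ✓`recordFluctMeasure`
(`gaussWeight M x = exp(−½xᵀMx)`), so `exp(𝐏 + {…})·dμ` is proportional to the full integrand BY CONSTRUCTION whatever ed.15c's polar normalisation of `recordΔk` is ((T2) fixes constants,
SAID in ed.15c); (c5) history currency `v` (`g = v (Fin.last k)`), as `phiFE`.

WHAT THIS FILE IS (definitions + `rfl`∕one-line faces; NEW names; nothing earlier touched): §24q `recordChartExp` (the tree's (0.19) exponent at the chart point), `recordDtCorrOf`∕`recordReparamOf`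
(`Y_g`), `recordDtJacOf` ((o3) formula), `recordRem` (`B_rem`), `recordGaussQuad`, ★ `recordTotalExpOf`, ★ `recordCurlyRecOf` (= ✓`recordEkBracket` at `Y_g`), ★ `recordPRecOf := total − curly`,
★★ `recordFluctDataDtOf`, ★★ `recordFluctIntDtOf Dt F Mc a₀ ε₂₉ ε₁ k v n B : ℝ`; faces `recordPRecOf_add_recordCurlyRecOf`, `recordReparamOf_zero_left`, `recordFluctIntDtOf_eq`.

HONEST FRAMING.  Definitions only; NOTHING of Bałaban's (2.10)–(2.14) is asserted, ported or discharged — in particular NOT the chart law (T1), NOT the exponent algebra (T2), NOT (2.14), NOT any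
analyticity∕localisation of `𝐏`; JUNK (said): `1∕g² = 0`-junk at `g = 0` (Mathlib), `Real.log` of a non-positive Jacobian is junk off the small-field regime, `Re` in (c2) exact only on the
bridge, the socket's `dite`∕`mlog`∕adjugate junk as SAID upstream; `stub_FE` (XXL) ∕ `stub_P0C` OPEN, ⟨27930⟩ OPEN (1∕3); K0⁷ ∕ K0ᴬ ∕ K1ᴬ ∕ K3ᴬ OPEN; NODE O 0∕1; COUNT 8∕28 · K 1∕4 UNMOVED; finite
`𝕋⁴_{L^K}` at fixed ε — NOT continuum ∕ ℝ⁴ ∕ OS; **the Yang–Mills mass gap (Clay) is NOT proved by any of this.**  No `sorry`, `instance`, `notation`; standard axioms.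
-/

noncomputable section

open scoped BigOperators Matrix.Norms.L2Operator

namespace Summit.QuantumFields.YangMills.Theorems.K0RecordFormatNames

open Literature.MathematicalPhysics.QuantumFieldTheory.Balaban1983to89
open Literature.MathematicalPhysics.QuantumFieldTheory.Balaban1983to89.Node00
open Literature.MathematicalPhysics.QuantumFieldTheory.Balaban1983to89.T4Continuum (T4Family)
open Literature.MathematicalPhysics.QuantumFieldTheory.Balaban1983to89.T4FlagMemory (extd)
open Summit.QuantumFields.YangMills.Theorems.BalabanUVNodesPortS1 (portVkAx hopLinGraph fluctVec fluctSigma)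
open _root_.Matrix

variable (F : T4Family)

/-! ## §24q  The total exponent by subtraction, over a `D̃`-socket -/

section Stage2

variable {K : ℕ} (k : ℕ)

/-- **THE TREE's (0.19)∕(2.1) EXPONENT AT THE CHART POINT**: `recordChartExp F a₀ ε₂₉ k v K B x := −(1∕g²)·GF(V′V^{(k)}) + A_k(V′V^{(k)})`, `g := v (Fin.last k)`, `V′V^{(k)} = pert (portVkAx … B) x`,
`GF = gfOfRecord` (ed.15's ✓`recordGf`), `A_k = effActionHT` over the record's transport∕cut-off tokens and the history `extd v` (the same tokens as ✓`recordTermsAx`∕✓`recordEkChart`) — the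
logarithm of ✓`B12Eq019ActionBody.integrand` without `χ`.  JUNK: `1∕0 = 0` at `g = 0`. [cite: Balaban1987RG1, (2.1) p.265, (0.19) p.255, (2.10) p.267] -/
def recordChartExp (a₀ ε₂₉ : ℝ) (v : Fin (k + 1) → ℝ) (B : recordW F a₀ ε₂₉ k K) (x : FluctIdx F k K → ℝ) : ℝ :=
  letI θ := thetaFill F a₀ ε₂₉
  effActionHT F 2 (TβOfRecord₁₃ F 2) (chiβOfRecord₁₃Ax F 2 θ) K (extd v) k (pert F k K (portVkAx F a₀ ε₂₉ k K B) x)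
    - (1 / (v (Fin.last k)) ^ 2) * recordGf F k K (portVkAx F a₀ ε₂₉ k K B) x

/-- **The `D̃`-correction in real coordinates**: `recordDtCorrOf Dt Vk y := Re ∘ h_ℂ(D̃_{Vk}(↑y))` — the `b₀`-supported field `hD̃(B)` of p.267 read on real coordinates (`Re` exact on the
real-to-`𝔰𝔲(2)` bridge of the consumer). [cite: Balaban1987RG1, p.267 («B′ = B − hD̃(B)»)] -/
def recordDtCorrOf (Dt : GaugeField (F.P K) k (SU 2) → (FluctIdx F k K → ℂ) → (PBond (F.P K) (k + 1) → MatA 2)) (Vk : GaugeField (F.P K) k (SU 2))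
    (y : FluctIdx F k K → ℝ) : FluctIdx F k K → ℝ :=
  fun i => (hopLinGraphC F k K Vk (Dt Vk fun j => ((y j : ℝ) : ℂ)) i).re

/-- ★ **THE RE-PARAMETRISED, SCALED CHART VARIABLE `Y_g(x) := g•x − hD̃(g•x)`** («B = g_kB′» then «B′ = B − hD̃(B)», p.267–268). [cite: Balaban1987RG1, p.267–268, (2.12) p.268] -/
def recordReparamOf (Dt : GaugeField (F.P K) k (SU 2) → (FluctIdx F k K → ℂ) → (PBond (F.P K) (k + 1) → MatA 2)) (Vk : GaugeField (F.P K) k (SU 2))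
    (g : ℝ) (x : FluctIdx F k K → ℝ) : FluctIdx F k K → ℝ :=
  g • x - recordDtCorrOf F k Dt Vk (g • x)

/-- ★ **SOCKET (o3) AS A FORMULA — the `D̃`-Jacobian** `log |det(1 − D(h∘D̃))|` of «B′ = B − hD̃(B)» at the scaled point `g•x` (a real number; junk off differentiability∕positivity, SAID).
[cite: Balaban1987RG1, p.267–268 («the above change of variables yields …»)] -/
def recordDtJacOf (Dt : GaugeField (F.P K) k (SU 2) → (FluctIdx F k K → ℂ) → (PBond (F.P K) (k + 1) → MatA 2)) (Vk : GaugeField (F.P K) k (SU 2))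
    (g : ℝ) (x : FluctIdx F k K → ℝ) : ℝ :=
  Real.log |LinearMap.det ((ContinuousLinearMap.id ℝ (FluctIdx F k K → ℝ) - fderiv ℝ (recordDtCorrOf F k Dt Vk) (g • x)).toLinearMap)|

/-- **The remaining variables of an all-coordinates vector**: `recordRem x := (i : NonB0Idx) ↦ x i.1`. [cite: Balaban1987RG1, p.268 («Denoting the remaining variables by B»)] -/
def recordRem (x : FluctIdx F k K → ℝ) : NonB0Idx F k K → ℝ := fun i => x i.1

/-- **The Gaussian part the socket's measure carries**: `½ · B_remᵀ · recordPreckLoc(…) · B_rem` (precision of ✓`recordFluctMeasure`, `gaussWeight M x = exp(−½xᵀMx)`).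
[cite: Balaban1987RG1, p.268, (2.11) p.267] -/
def recordGaussQuad (a₀ ε₂₉ : ℝ) (B : recordW F a₀ ε₂₉ k K) (x : FluctIdx F k K → ℝ) : ℝ :=
  (1 / 2 : ℝ) * dotProduct (recordRem F k x)
    (recordPreckLoc F k K a₀ (portVkAx F a₀ ε₂₉ k K B) (hopLinGraph F k K (portVkAx F a₀ ε₂₉ k K B)) *ᵥ recordRem F k x)

/-- ★ **THE TOTAL EXPONENT `𝐏^{(k)} + {…}` BY SUBTRACTION** at `(g, B, B′)`: the chart exponent at `Y_g(x)` minus its value at `0` (print's displayed «constants»), plus the Gaussian part the measure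
took out, plus the two Jacobians (`log σ(Y_g(x))` — ✓`fluctSigma`, `chartJac 0 = 1` so no constant — and the `D̃`-Jacobian), `x := fluctVec⁻¹ B′`. [cite: Balaban1987RG1, (2.10)–(2.12) pp.267–268] -/
def recordTotalExpOf (Dt : GaugeField (F.P K) k (SU 2) → (FluctIdx F k K → ℂ) → (PBond (F.P K) (k + 1) → MatA 2)) (a₀ ε₂₉ : ℝ) (v : Fin (k + 1) → ℝ)
    (g : ℝ) (B : recordW F a₀ ε₂₉ k K) (B' : VecField (F.P K) k fluctG3) : ℝ :=
  letI x : FluctIdx F k K → ℝ := (fluctVec F k K).symm B'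
  letI Y : FluctIdx F k K → ℝ := recordReparamOf F k Dt (portVkAx F a₀ ε₂₉ k K B) g x
  recordChartExp F k a₀ ε₂₉ v B Y - recordChartExp F k a₀ ε₂₉ v B 0 + recordGaussQuad F k a₀ ε₂₉ B x
    + Real.log (fluctSigma (fluctVec F k K Y)) + recordDtJacOf F k Dt (portVkAx F a₀ ε₂₉ k K B) g x

/-- ★ **THE CURLY BRACKET `{𝐄_k(U_k(exp i[g_kCB − hD̃(g_kCB)]V^{(k)})) − 𝐄_k(U_k(V^{(k)}))}`** = ✓`recordEkBracket` ((o4-a)) at `Y_g(x)`. [cite: Balaban1987RG1, (2.12) p.268] -/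
def recordCurlyRecOf (Dt : GaugeField (F.P K) k (SU 2) → (FluctIdx F k K → ℂ) → (PBond (F.P K) (k + 1) → MatA 2)) (a₀ ε₂₉ : ℝ) (v : Fin (k + 1) → ℝ)
    (g : ℝ) (B : recordW F a₀ ε₂₉ k K) (B' : VecField (F.P K) k fluctG3) : ℝ :=
  recordEkBracket F a₀ ε₂₉ k v K B (recordReparamOf F k Dt (portVkAx F a₀ ε₂₉ k K B) g ((fluctVec F k K).symm B'))

/-- ★ **`𝐏^{(k)}(g_k, U_{k+1}, B′) := total − {…}`** — print's name for «the rest». [cite: Balaban1987RG1, (2.12)–(2.13) p.268] -/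
def recordPRecOf (Dt : GaugeField (F.P K) k (SU 2) → (FluctIdx F k K → ℂ) → (PBond (F.P K) (k + 1) → MatA 2)) (a₀ ε₂₉ : ℝ) (v : Fin (k + 1) → ℝ)
    (g : ℝ) (B : recordW F a₀ ε₂₉ k K) (B' : VecField (F.P K) k fluctG3) : ℝ :=
  recordTotalExpOf F k Dt a₀ ε₂₉ v g B B' - recordCurlyRecOf F k Dt a₀ ε₂₉ v g B B'

/-- FACE: `𝐏 + {…} = total` (by construction). [cite: Balaban1987RG1, (2.12) p.268 (bookkeeping)] -/
theorem recordPRecOf_add_recordCurlyRecOf (Dt : GaugeField (F.P K) k (SU 2) → (FluctIdx F k K → ℂ) → (PBond (F.P K) (k + 1) → MatA 2)) (a₀ ε₂₉ : ℝ)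
    (v : Fin (k + 1) → ℝ) (g : ℝ) (B : recordW F a₀ ε₂₉ k K) (B' : VecField (F.P K) k fluctG3) :
    recordPRecOf F k Dt a₀ ε₂₉ v g B B' + recordCurlyRecOf F k Dt a₀ ε₂₉ v g B B' = recordTotalExpOf F k Dt a₀ ε₂₉ v g B B' :=
  sub_add_cancel _ _

/-- FACE: at `g = 0` the scaled variable is `0` whatever `x` is: `Y_0(x) = −hD̃(0)` (and `= 0` once `D̃(0) = 0`, the consumer's spec). [cite: Balaban1987RG1, (2.14) p.268 (bookkeeping)] -/
theorem recordReparamOf_zero_left (Dt : GaugeField (F.P K) k (SU 2) → (FluctIdx F k K → ℂ) → (PBond (F.P K) (k + 1) → MatA 2)) (Vk : GaugeField (F.P K) k (SU 2))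
    (x : FluctIdx F k K → ℝ) : recordReparamOf F k Dt Vk 0 x = -recordDtCorrOf F k Dt Vk 0 := by
  simp [recordReparamOf]

/-- ★★ **THE RECORD `FluctData` OVER THE `D̃`-SOCKET**: the stage-1b socket ✓`recordFluctDataOf` PINNED at the exponents `𝐏_rec`∕`{…}_rec` above (cut-off radius `ε₁` in the scaled variable, (c3)).
[cite: Balaban1987RG1, (2.12)–(2.13) p.268, (2.9) p.266] -/
def recordFluctDataDtOf (Dt : GaugeField (F.P K) k (SU 2) → (FluctIdx F k K → ℂ) → (PBond (F.P K) (k + 1) → MatA 2)) (a₀ ε₂₉ ε₁ : ℝ) (v : Fin (k + 1) → ℝ) :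
    B12Eq213Body268.FluctData (recordW F a₀ ε₂₉ k K) :=
  recordFluctDataOf F a₀ ε₂₉ k K ε₁ (recordPRecOf F k Dt a₀ ε₂₉ v) (recordCurlyRecOf F k Dt a₀ ε₂₉ v)

end Stage2

/-- ★★★ **(2.13) AT THE RECORD OVER THE `D̃`-SOCKET — `recordFluctIntDtOf F Dt Mc a₀ ε₂₉ ε₁ k v n B := (recordFluctDataDtOf …).newTerm (v (Fin.last k)) B`** =
«𝐄^{(k+1)}(g_k, U_{k+1}(W_B)) = log ∫ dμ_{C^{(k)}}(B′) χ_k exp[𝐏^{(k)}(g_k, U_{k+1}, B′) + {…}]» at volume `recordK₀ F Mc k + n`, history `v` (`g_k = v (Fin.last k)`); the socket `Dt` is indexed by the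
volume `K` (it is applied at `K := recordK₀ F Mc k + n`).  The CLOSED `recordFluctInt` of ▶ PT-A-1's FE-SPLIT §1 ∕ ★★★ №594 (5) is THIS at `Dt := recordDt …` (next leaf, one line).
[cite: Balaban1987RG1, (2.13) p.268] -/
def recordFluctIntDtOf (k : ℕ) (Dt : (K : ℕ) → GaugeField (F.P K) k (SU 2) → (FluctIdx F k K → ℂ) → (PBond (F.P K) (k + 1) → MatA 2)) (Mc : ℕ) (a₀ ε₂₉ ε₁ : ℝ)
    (v : Fin (k + 1) → ℝ) (n : ℕ) (B : recordW F a₀ ε₂₉ k (recordK₀ F Mc k + n)) : ℝ :=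
  (recordFluctDataDtOf F k (Dt (recordK₀ F Mc k + n)) a₀ ε₂₉ ε₁ v).newTerm (v (Fin.last k)) B

/-- Unfolding (`rfl`). [cite: Balaban1987RG1, (2.13) p.268 (bookkeeping)] -/
theorem recordFluctIntDtOf_eq (k : ℕ) (Dt : (K : ℕ) → GaugeField (F.P K) k (SU 2) → (FluctIdx F k K → ℂ) → (PBond (F.P K) (k + 1) → MatA 2)) (Mc : ℕ) (a₀ ε₂₉ ε₁ : ℝ)
    (v : Fin (k + 1) → ℝ) (n : ℕ) (B : recordW F a₀ ε₂₉ k (recordK₀ F Mc k + n)) :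
    recordFluctIntDtOf F k Dt Mc a₀ ε₂₉ ε₁ v n B =
      (recordFluctDataDtOf F k (Dt (recordK₀ F Mc k + n)) a₀ ε₂₉ ε₁ v).newTerm (v (Fin.last k)) B := rfl

end Summit.QuantumFields.YangMills.Theorems.K0RecordFormatNames

end
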